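import Literature.Computability.QuantumComplexity.QuantumAdvantageWave0
import Literature.Computability.Cryptography.QuantumCircuit
import Literature.MathematicalPhysics.QuantumLattice.GaugeGroups
import HarnessLib

/-!
# Truncations of Haar-random unitaries (Aaronson–Arkhipov 2013, §5.1)

Family `quantum-advantage`; an ingredient of the proof of AA13's Main Theorem (Thm. 1.3, vendored
as the named fact `gpeSolvableInFBPPRel_NP_of_uniformApproxBosonSampling` in
`BosonSamplingHardness.lean`). Source: S. Aaronson, A. Arkhipov, *The computational complexity
of linear optics*, Theory of Computing 9 (2013) 143–252, §5.1 "Truncations of Haar-random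
unitaries", Thm. 5.1 and Thm. 5.2 (Haar-Unitary Hiding Theorem), both p. 183 (journal
pagination; proofs pp. 183–190).

Printed statements. `𝒰_{m,n}` is the set of `m × n` complex matrices with orthonormal columns,
`ℋ_{m,m}` the Haar measure on `U(m)`; `𝒮_{m,n}` is "the distribution over `n × n` matrices
obtained by first drawing a unitary `U` from `ℋ_{m,m}` and then outputting `√m · U_{n,n}`, where
`U_{n,n}` is the top-left `n × n` submatrix of `U`"; `𝒢^{n×n}` is the law of an `n × n` matrix of
independent standard complex Gaussians (mean `0`, `E|x|² = 1`).

* **Thm. 5.1.** Let `m ≥ (n⁵/δ) log²(n/δ)` for any `δ > 0`. Then `‖𝒮_{m,n} − 𝒢^{n×n}‖ = O(δ)`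
  (variation distance).
* **Thm. 5.2 (Haar-Unitary Hiding Theorem).** Let `m ≥ (n⁵/δ) log²(n/δ)`. Then
  `p_S(X) ≤ (1 + O(δ)) p_G(X)` for all `X ∈ ℂ^{n×n}`, `p_S, p_G` the densities of `𝒮_{m,n}`,
  `𝒢^{n×n}`.

## Tree form and design choices

* `𝒮_{m,n}` is `truncatedHaarMeasure m n h` (`h : n ≤ m`): the push-forward of the tree's
  normalised Haar measure `ConstructiveQFT.haarProbability (Matrix.unitaryGroup (Fin m) ℂ)`
  (compactness and Borel instances from `GaugeGroups.lean`) along `scaledTruncation`,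
  `U ↦ (√m · U i j)_{i,j < n}`, valued in `Fin n → Fin n → ℂ` — the carrier of the tree's
  Gaussian ensemble `gaussianMatrixMeasure n` (Wave0), whose entries are standard complex
  Gaussians (`stdComplexGaussian`, real and imaginary parts `𝒩(0, 1/2)`), as in AA13.
* **Measure form of the density inequality.** Thm. 5.2 is stated as
  `𝒮_{m,n}(E) ≤ (1 + Cδ) · 𝒢^{n×n}(E)` for every measurable `E`. For measures with densities
  this is equivalent to the printed pointwise inequality Lebesgue-a.e. (integrate over `E`;
  conversely differentiate), and it needs neither the existence of `p_S` (AA13 take it from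
  Petz–Réffy, for `m ≥ 2n`) nor the constant `c_{m,n}`.
* **The `O(δ)`.** Big-O "for any `δ > 0`" is read, as usual, as an absolute constant for all
  sufficiently small `δ`: `∃ C δ₀ > 0, ∀ δ ∈ (0, δ₀], …`, uniformly in `n ≥ 1`, `m` and `E`. Some
  restriction to small `δ` is forced: for large `δ` (e.g. `δ = n⁵`, `n ≥ 800`, where
  `16 ln² n ≤ n`) the hypothesis allows `m = n`, and `𝒮_{n,n} = √n · Haar` is singular to
  Lebesgue measure, so no inequality of this shape holds. The base of the logarithm in the
  threshold is immaterial given the existential `C, δ₀` (replacing `δ` by `δ / ln² 2` turns the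
  threshold with `log₂` into one below the threshold with `ln` as soon as `n/δ ≥ 2`, and the
  factor `ln² 2` moves into `C` and `δ₀`); the natural logarithm `Real.log` is used.
* Thm. 5.1 in the same form (`|𝒮(E) − 𝒢(E)| ≤ Cδ` for all measurable `E`, i.e. variation
  distance `≤ Cδ`) is *proved* here from Thm. 5.2 (`haarUnitaryTruncation_tv_of_hiding`:
  apply the one-sided bound to `E` and to `Eᶜ`), exactly as AA13 note that Thm. 5.2 is "the
  stronger version" they actually need.
* **Row symmetry** (proved, section "Row symmetry of Haar truncations"): for every injective
  row selection `ι : Fin n → Fin m` the scaled block `(√m · U (ι i) j)_{i,j<n}`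
  (`scaledRowSubmatrix`) of a Haar-random `U` has law `𝒮_{m,n}`
  (`map_scaledRowSubmatrix_haar_eq_truncatedHaarMeasure`) — the symmetry invoked in the proofs
  of Lemma 5.8 (p. 192) and Thm. 1.3 (p. 194, "symmetry principle"); by left-invariance of the
  Haar measure under the unitary permutation matrices (`permUnitary`).

What a discharge of `haarUnitaryHiding` would need (AA13 §5.1, pp. 183–190): the explicit density
of `𝒮_{m,n}` for `m ≥ 2n` (Petz–Réffy; AA13 eqs. (5.2)–(5.6)), the normalising-constant estimate
Lemma 5.3–5.6 and the eigenvalue tail bound; classical random-matrix analysis not in Mathlib.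
-/

open MeasureTheory Matrix

namespace Literature.Computability.QuantumComplexity

/-! ### The scaled truncation of a Haar unitary -/

/-- The scaled top-left truncation `U ↦ √m · U_{n,n}` of an `m × m` unitary (`n ≤ m`), as an
array `Fin n → Fin n → ℂ` (read as a matrix through `Matrix.of`, like `gaussianMatrixMeasure`).
(AA13 §5.1, definition of `𝒮_{m,n}`, p. 183.) [cite: AaronsonArkhipovToC2013, §5.1 (p. 183)] -/
noncomputable def scaledTruncation {m : ℕ} (n : ℕ) (h : n ≤ m)
    (U : Matrix.unitaryGroup (Fin m) ℂ) : Fin n → Fin n → ℂ :=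
  fun i j => (Real.sqrt m : ℂ) * (U : Matrix (Fin m) (Fin m) ℂ) (Fin.castLE h i) (Fin.castLE h j)

/-- Unfolding lemma for `scaledTruncation`. [folklore] -/
@[simp] theorem scaledTruncation_apply {m : ℕ} (n : ℕ) (h : n ≤ m)
    (U : Matrix.unitaryGroup (Fin m) ℂ) (i j : Fin n) :
    scaledTruncation n h U i j =
      (Real.sqrt m : ℂ) * (U : Matrix (Fin m) (Fin m) ℂ) (Fin.castLE h i) (Fin.castLE h j) :=
  rfl

/-- The scaled truncation is continuous (entries of the underlying matrix, times a constant).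
[folklore] -/
theorem continuous_scaledTruncation {m : ℕ} (n : ℕ) (h : n ≤ m) :
    Continuous (scaledTruncation (m := m) n h) := by
  refine continuous_pi fun i => continuous_pi fun j => ?_
  have hval : Continuous fun U : Matrix.unitaryGroup (Fin m) ℂ => (U : Matrix (Fin m) (Fin m) ℂ) :=
    continuous_subtype_val
  have hrow : Continuous fun U : Matrix.unitaryGroup (Fin m) ℂ =>
      (U : Matrix (Fin m) (Fin m) ℂ) (Fin.castLE h i) :=
    (continuous_apply (Fin.castLE h i)).comp hval
  have hU : Continuous fun U : Matrix.unitaryGroup (Fin m) ℂ =>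
      (U : Matrix (Fin m) (Fin m) ℂ) (Fin.castLE h i) (Fin.castLE h j) :=
    (continuous_apply (Fin.castLE h j)).comp hrow
  exact continuous_const.mul hU

/-- The scaled truncation is (Borel) measurable. [folklore] -/
theorem measurable_scaledTruncation {m : ℕ} (n : ℕ) (h : n ≤ m) :
    Measurable (scaledTruncation (m := m) n h) :=
  (continuous_scaledTruncation n h).measurable

/-- **`𝒮_{m,n}`**, the law of the scaled `n × n` truncation `√m · U_{n,n}` of a Haar-random
`U ∈ U(m)` (`n ≤ m`): the push-forward of the normalised Haar measure of `U(m)` along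
`scaledTruncation`. (AA13 §5.1, p. 183: "the distribution over `n × n` truncations of `m × m` Haar
unitary matrices, where the entries have been scaled up by a factor of `√m` so that they have
mean 0 and variance 1".) [cite: AaronsonArkhipovToC2013, §5.1 (p. 183)] -/
noncomputable def truncatedHaarMeasure (m n : ℕ) (h : n ≤ m) : Measure (Fin n → Fin n → ℂ) :=
  (Literature.MathematicalPhysics.QuantumFieldTheory.haarProbability (Matrix.unitaryGroup (Fin m) ℂ)).map (scaledTruncation n h)

/-- `𝒮_{m,n}` is a probability measure (push-forward of the Haar probability measure along a
measurable map). [folklore] -/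
instance truncatedHaarMeasure.instIsProbabilityMeasure (m n : ℕ) (h : n ≤ m) :
    IsProbabilityMeasure (truncatedHaarMeasure m n h) := by
  unfold truncatedHaarMeasure
  exact Measure.isProbabilityMeasure_map (measurable_scaledTruncation n h).aemeasurable

/-! ### The hiding theorems as named facts -/

/-- **Haar-Unitary Hiding Theorem** (AA13 Thm. 5.2, p. 183), measure form. There are absolute
constants `C` and `δ₀ > 0` such that for all `n ≥ 1`, all `δ ∈ (0, δ₀]` and all
`m ≥ (n⁵/δ) log²(n/δ)`, the law `𝒮_{m,n}` of the scaled truncation of a Haar unitary is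
dominated by `(1 + Cδ)` times the Gaussian ensemble `𝒢^{n×n}`:
`𝒮_{m,n}(E) ≤ (1 + Cδ) 𝒢^{n×n}(E)` for every measurable `E ⊆ ℂ^{n×n}` — the integrated form
of the printed density inequality `p_S(X) ≤ (1 + O(δ)) p_G(X)` for all `X` (see the module
docstring for the reading of `O(δ)` and of the logarithm). Not in Mathlib (random-matrix
theory of truncated unitaries); stated as a `Prop`.
[cite: AaronsonArkhipovToC2013, Thm. 5.2 (p. 183)] -/
def haarUnitaryHiding : Prop :=
  ∃ C δ₀ : ℝ, 0 < δ₀ ∧ ∀ (n m : ℕ) (h : n ≤ m) (δ : ℝ), 1 ≤ n → 0 < δ → δ ≤ δ₀ →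
    (n : ℝ) ^ 5 / δ * Real.log (n / δ) ^ 2 ≤ m →
    ∀ E : Set (Fin n → Fin n → ℂ), MeasurableSet E →
      (truncatedHaarMeasure m n h).real E ≤ (1 + C * δ) * (gaussianMatrixMeasure n).real E

/-- **Truncations of Haar unitaries are close to Gaussian** (AA13 Thm. 5.1, p. 183), in the same
form: there are absolute constants `C` and `δ₀ > 0` such that for all `n ≥ 1`, `δ ∈ (0, δ₀]` and
`m ≥ (n⁵/δ) log²(n/δ)`, `|𝒮_{m,n}(E) − 𝒢^{n×n}(E)| ≤ Cδ` for every measurable `E`, i.e. the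
variation distance `‖𝒮_{m,n} − 𝒢^{n×n}‖` is `O(δ)`. Proved below from Thm. 5.2
(`haarUnitaryTruncation_tv_of_hiding`). [cite: AaronsonArkhipovToC2013, Thm. 5.1 (p. 183)] -/
def haarUnitaryTruncation_tv : Prop :=
  ∃ C δ₀ : ℝ, 0 < δ₀ ∧ ∀ (n m : ℕ) (h : n ≤ m) (δ : ℝ), 1 ≤ n → 0 < δ → δ ≤ δ₀ →
    (n : ℝ) ^ 5 / δ * Real.log (n / δ) ^ 2 ≤ m →
    ∀ E : Set (Fin n → Fin n → ℂ), MeasurableSet E →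
      |(truncatedHaarMeasure m n h).real E - (gaussianMatrixMeasure n).real E| ≤ C * δ

/-! ### API (proved) -/

/-- One-sided domination by `(1 + Cδ)` of a probability measure by another gives two-sided
closeness `|μ(E) − ν(E)| ≤ max C 0 · δ`: apply the bound to `E` (upper) and to `Eᶜ` (lower, via
`μ(Eᶜ) = 1 − μ(E)`). This is how Thm. 5.1 follows from Thm. 5.2. [folklore] -/
theorem abs_measureReal_sub_le_of_dominated {α : Type*} [MeasurableSpace α]
    (μ ν : Measure α) [IsProbabilityMeasure μ] [IsProbabilityMeasure ν] {C δ : ℝ} (hδ : 0 ≤ δ)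
    (hdom : ∀ E : Set α, MeasurableSet E → μ.real E ≤ (1 + C * δ) * ν.real E)
    {E : Set α} (hE : MeasurableSet E) :
    |μ.real E - ν.real E| ≤ max C 0 * δ := by
  have hC : C * δ ≤ max C 0 * δ := mul_le_mul_of_nonneg_right (le_max_left C 0) hδ
  have hνE : ν.real E ≤ 1 := measureReal_le_one
  have hνEc : ν.real Eᶜ ≤ 1 := measureReal_le_one
  have hνE0 : 0 ≤ ν.real E := measureReal_nonneg
  have hνEc0 : 0 ≤ ν.real Eᶜ := measureReal_nonneg
  have h1 := hdom E hE
  have h2 := hdom Eᶜ hE.compl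
  have hμc : μ.real Eᶜ = 1 - μ.real E := by
    rw [measureReal_compl hE, probReal_univ]
  have hνc : ν.real Eᶜ = 1 - ν.real E := by
    rw [measureReal_compl hE, probReal_univ]
  have hCδ0 : 0 ≤ max C 0 * δ := mul_nonneg (le_max_right C 0) hδ
  rw [abs_le]
  constructor
  · -- lower bound from the complement
    rw [hμc, hνc] at h2
    nlinarith
  · nlinarith

/-- **Thm. 5.1 from Thm. 5.2**: the hiding inequality `𝒮 ≤ (1 + Cδ) 𝒢` on all measurable sets
gives `‖𝒮_{m,n} − 𝒢^{n×n}‖ ≤ max(C,0) · δ` (AA13 §5.1, p. 183: Thm. 5.2 is "the following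
stronger version of Theorem 5.1"). [cite: AaronsonArkhipovToC2013, Thms. 5.1–5.2 (p. 183)] -/
theorem haarUnitaryTruncation_tv_of_hiding (H : haarUnitaryHiding) :
    haarUnitaryTruncation_tv := by
  obtain ⟨C, δ₀, hδ₀, hH⟩ := H
  refine ⟨max C 0, δ₀, hδ₀, fun n m h δ hn hδ hδ' hm E hE => ?_⟩
  exact abs_measureReal_sub_le_of_dominated _ _ hδ.le (hH n m h δ hn hδ hδ' hm) hE

/-! ### Row symmetry of Haar truncations

The symmetry fact behind AA13's hiding argument: for a Haar-random `U ∈ U(m)` the scaled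
`n × n` block cut out by *any* `n` distinct rows `ι 0, …, ι (n−1)` of the first `n` columns has
the same law `𝒮_{m,n}` as the top-left block — used in the proof of the Hiding Lemma 5.8
(p. 192: "by symmetry, this `X′` occurs at a uniformly-random location", and "we could equally
well have sampled `A ∼ 𝒟_X` by first sampling `X ∼ 𝒮_{m,n}`, then placing `X′` at a
uniformly-random location within `A` …") and again as the "symmetry principle" of the proof of
Thm. 1.3 (p. 194: "we could have equally well generated the pair `⟨X, A⟩` by first sampling `A`
from the Haar measure `ℋ_{m,n}` and then setting `X := √m A_{S*}` for `S*` chosen uniformly from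
`G_{m,n}`"). Proof: permuting rows is left multiplication by a permutation matrix, which is
unitary, and the Haar measure of `U(m)` is left-invariant. -/

/-- The scaled `n × n` submatrix of `U ∈ U(m)` on the rows `ι 0, …, ι (n−1)` (any row selection
`ι : Fin n → Fin m`) of the first `n` columns: `(√m · U (ι i) j)_{i,j<n}`. For `ι = Fin.castLE h`
this is `scaledTruncation n h` (`scaledRowSubmatrix_castLE`). (AA13 §5.2, p. 192: "`X/√m` occurs
as a uniformly-random `n × n` submatrix of `A`".) [cite: AaronsonArkhipovToC2013, Lemma 5.8 (i) (p. 191)] -/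
noncomputable def scaledRowSubmatrix {m : ℕ} (n : ℕ) (h : n ≤ m) (ι : Fin n → Fin m)
    (U : Matrix.unitaryGroup (Fin m) ℂ) : Fin n → Fin n → ℂ :=
  fun i j => (Real.sqrt m : ℂ) * (U : Matrix (Fin m) (Fin m) ℂ) (ι i) (Fin.castLE h j)

/-- Unfolding lemma for `scaledRowSubmatrix`. [folklore] -/
@[simp] theorem scaledRowSubmatrix_apply {m : ℕ} (n : ℕ) (h : n ≤ m) (ι : Fin n → Fin m)
    (U : Matrix.unitaryGroup (Fin m) ℂ) (i j : Fin n) :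
    scaledRowSubmatrix n h ι U i j =
      (Real.sqrt m : ℂ) * (U : Matrix (Fin m) (Fin m) ℂ) (ι i) (Fin.castLE h j) :=
  rfl

/-- The top rows give back the scaled truncation. [folklore] -/
theorem scaledRowSubmatrix_castLE {m : ℕ} (n : ℕ) (h : n ≤ m) :
    scaledRowSubmatrix n h (Fin.castLE h) = scaledTruncation (m := m) n h :=
  rfl

/-- `scaledRowSubmatrix` is continuous. [folklore] -/
theorem continuous_scaledRowSubmatrix {m : ℕ} (n : ℕ) (h : n ≤ m) (ι : Fin n → Fin m) :
    Continuous (scaledRowSubmatrix (m := m) n h ι) := by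
  refine continuous_pi fun i => continuous_pi fun j => ?_
  have hval : Continuous fun U : Matrix.unitaryGroup (Fin m) ℂ => (U : Matrix (Fin m) (Fin m) ℂ) :=
    continuous_subtype_val
  have hrow : Continuous fun U : Matrix.unitaryGroup (Fin m) ℂ =>
      (U : Matrix (Fin m) (Fin m) ℂ) (ι i) :=
    (continuous_apply (ι i)).comp hval
  have hU : Continuous fun U : Matrix.unitaryGroup (Fin m) ℂ =>
      (U : Matrix (Fin m) (Fin m) ℂ) (ι i) (Fin.castLE h j) :=
    (continuous_apply (Fin.castLE h j)).comp hrow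
  exact continuous_const.mul hU

/-- `scaledRowSubmatrix` is (Borel) measurable. [folklore] -/
theorem measurable_scaledRowSubmatrix {m : ℕ} (n : ℕ) (h : n ≤ m) (ι : Fin n → Fin m) :
    Measurable (scaledRowSubmatrix (m := m) n h ι) :=
  (continuous_scaledRowSubmatrix n h ι).measurable

/-- The permutation matrix `P_σ` (`(P_σ)_{i j} = [j = σ i]`) as an element of `U(m)`
(permutation matrices are unitary: `Literature.Computability.Cryptography.permMatrix_mem_unitaryGroup`,
`QuantumCircuit.lean`); left multiplication by it permutes rows: `(P_σ U)_{i k} = U_{σ i, k}`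
(`permUnitary_mul_apply`). [folklore] -/
noncomputable def permUnitary {m : ℕ} (σ : Equiv.Perm (Fin m)) : Matrix.unitaryGroup (Fin m) ℂ :=
  ⟨σ.permMatrix ℂ, Literature.Computability.Cryptography.permMatrix_mem_unitaryGroup σ⟩

/-- Left multiplication by `P_σ` permutes the rows: `(P_σ U)_{i k} = U_{σ i, k}`. [folklore] -/
theorem permUnitary_mul_apply {m : ℕ} (σ : Equiv.Perm (Fin m)) (U : Matrix.unitaryGroup (Fin m) ℂ)
    (i k : Fin m) :
    ((permUnitary σ * U : Matrix.unitaryGroup (Fin m) ℂ) : Matrix (Fin m) (Fin m) ℂ) i k =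
      (U : Matrix (Fin m) (Fin m) ℂ) (σ i) k := by
  show ((σ.toPEquiv.toMatrix : Matrix (Fin m) (Fin m) ℂ) * (U : Matrix (Fin m) (Fin m) ℂ)) i k = _
  rw [PEquiv.toMatrix_toPEquiv_mul, Matrix.submatrix_apply, id]

/-- Selecting the rows `σ (0), …, σ (n−1)` is truncating after the row permutation `P_σ`.
[folklore] -/
theorem scaledRowSubmatrix_perm_comp_castLE {m : ℕ} (n : ℕ) (h : n ≤ m) (σ : Equiv.Perm (Fin m)) :
    scaledRowSubmatrix n h (σ ∘ Fin.castLE h) =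
      scaledTruncation (m := m) n h ∘ fun U => permUnitary σ * U := by
  funext U
  ext i j
  simp only [scaledRowSubmatrix_apply, Function.comp_apply, scaledTruncation_apply,
    permUnitary_mul_apply]

/-- The normalised Haar measure of `U(m)` is invariant under left multiplication (Mathlib's
`haarMeasure` is a left Haar measure). [folklore] -/
theorem map_mul_left_haarProbability_unitaryGroup {m : ℕ} (g : Matrix.unitaryGroup (Fin m) ℂ) :
    (Literature.MathematicalPhysics.QuantumFieldTheory.haarProbability (Matrix.unitaryGroup (Fin m) ℂ)).map (fun U => g * U) =
      Literature.MathematicalPhysics.QuantumFieldTheory.haarProbability (Matrix.unitaryGroup (Fin m) ℂ) := by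
  unfold Literature.MathematicalPhysics.QuantumFieldTheory.haarProbability
  exact map_mul_left_eq_self _ g

/-- **Row symmetry of Haar truncations**: for every injective row selection `ι : Fin n → Fin m`,
the law of the scaled block `(√m · U (ι i) j)_{i,j<n}` of a Haar-random `U ∈ U(m)` is `𝒮_{m,n}`,
the law of the top-left block — the symmetry used in AA13's Hiding Lemma 5.8 ("by symmetry, this
`X′` occurs at a uniformly-random location", p. 192) and in the symmetry principle of the proof of
Thm. 1.3 (p. 194). Proof: extend `(Fin.castLE h, ι)` to a permutation `σ` of the rows
(`Equiv.Perm.exists_extending_pair`), write the selection as truncation after left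
multiplication by the unitary `P_σ`, and use left-invariance of the Haar measure.
[cite: AaronsonArkhipovToC2013, Lemma 5.8 proof (p. 192) and Thm. 1.3 proof (p. 194)] -/
theorem map_scaledRowSubmatrix_haar_eq_truncatedHaarMeasure {m n : ℕ} (h : n ≤ m)
    {ι : Fin n → Fin m} (hι : Function.Injective ι) :
    (Literature.MathematicalPhysics.QuantumFieldTheory.haarProbability (Matrix.unitaryGroup (Fin m) ℂ)).map
        (scaledRowSubmatrix n h ι) = truncatedHaarMeasure m n h := by
  obtain ⟨σ, hσ⟩ :=
    Equiv.Perm.exists_extending_pair (Fin.castLE h) ι (Fin.castLE_injective h) hι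
  have hι' : ι = σ ∘ Fin.castLE h := funext fun i => (hσ i).symm
  rw [hι', scaledRowSubmatrix_perm_comp_castLE,
    ← Measure.map_map (measurable_scaledTruncation n h) (measurable_const_mul (permUnitary σ)),
    map_mul_left_haarProbability_unitaryGroup]
  rfl

/-- In particular all row selections have the same law (row-exchangeability of the first `n`
columns of a Haar unitary, at the level of `n × n` blocks). [folklore] -/
theorem map_scaledRowSubmatrix_haar_eq {m n : ℕ} (h : n ≤ m) {ι κ : Fin n → Fin m}
    (hι : Function.Injective ι) (hκ : Function.Injective κ) :
    (Literature.MathematicalPhysics.QuantumFieldTheory.haarProbability (Matrix.unitaryGroup (Fin m) ℂ)).map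
        (scaledRowSubmatrix n h ι) =
      (Literature.MathematicalPhysics.QuantumFieldTheory.haarProbability (Matrix.unitaryGroup (Fin m) ℂ)).map
        (scaledRowSubmatrix n h κ) := by
  rw [map_scaledRowSubmatrix_haar_eq_truncatedHaarMeasure h hι,
    map_scaledRowSubmatrix_haar_eq_truncatedHaarMeasure h hκ]

end Literature.Computability.QuantumComplexity
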